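import Literature.MathematicalPhysics.QuantumFieldTheory.TomboulisVortexDecimation
import HarnessLib

/-!
# The centre sign flip in Tomboulis's character-truncated `SU(2)` model: negating the half-integer
# coefficients is the same as twisting every plaquette

Topic `Literature/MathematicalPhysics/QuantumFieldTheory`, in the vocabulary of
`TomboulisVortexDecimation.lean` (namespace `Tomboulis2007`: `plaqFn`, `plaqFnTwist`, `torusZ`,
`torusZtw`, `scaleCoeff`). Theorems only; no new definition, no new fact.

Tomboulis, arXiv:0707.2179 §4 (text before (4.1)–(4.4)) [Tomboulis2007Confinement]: the twisted partition
function replaces the plaquette function `f(U_p) = 1 + Σ_{j≠0} d_j c_j χ_j(U_p)` by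
`f(-U_p) = 1 + Σ_{j≠0} (-1)^{2j} d_j c_j χ_j(U_p)` on the plaquettes of the twist set `𝒱` — "only
half-integer representations on plaquettes in 𝒱 are affected" — and "is invariant under changes mod 2 in
the number of homologous coclosed sets carrying a twist". The elementary bookkeeping half of this is
recorded here as kernel theorems: replacing the coefficient sequence `c` by `n ↦ (-1)^n c(n)` (`n = 2j`)
turns `f` into `f(-·)` and `f(-·)` into `f` pointwise (`plaqFn_negOdd`, `plaqFnTwist_negOdd`), hence the
twisted partition function with coefficients `(-1)^n c(n)` and twist set `V` equals the one with
coefficients `c` and the COMPLEMENTARY twist set `Vᶜ` (`torusZtw_negOdd`); in particular the untwisted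
`Z` at `(-1)^n c(n)` is the partition function twisted on EVERY plaquette (`torusZ_negOdd`). On the
one-character ray `c = (s, 0, 0, …)` (spin cut-off `J = 1`) this is the substitution `s ↦ -s`:
`Z(-s) = Z_{all plaquettes twisted}(s)` and `Z⁻_V(-s) = Z_{Vᶜ}(s)` (`torusZ_one_scaleCoeff_neg`,
`torusZtw_one_scaleCoeff_neg`) — the identity behind the "`β ↦ -β`" symmetry of `SU(2)` lattice gauge
theory on even lattices (Li–Meurice, Phys. Rev. D 71 (2005) 016008, §4: `Z(-β) = e^{2β𝒩_p} Z(β)` by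
`U_l ↦ -U_l` on a set of links meeting every plaquette once) and behind the parity structure of the exact
small-volume census polynomials of the truncated model (cell pub-ymgap, lit/LIT2-TOMBOULIS-ITOSEILER.md §I).
The measure-theoretic half — that `torusZtw` depends only on the `ℤ/2` cohomology class of a coclosed
`V` (Haar invariance under `U_b ↦ -U_b`) — is NOT proved here.

HONEST FRAMING: pointwise algebraic identities between the integrands; nothing about signs, monotonicity,
confinement or any limit.

## References
* [Tomboulis2007Confinement] E. T. Tomboulis, Confinement for all values of the coupling in
  four-dimensional SU(2) gauge theory, arXiv:0707.2179, §4.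
* [LiMeurice2004] L. Li, Y. Meurice, Lattice gluodynamics at negative g², Phys. Rev. D 71 (2005) 016008,
  arXiv:hep-lat/0410029, §4 and Appendix.
-/

noncomputable section

open MeasureTheory Finset Real
open scoped BigOperators
open Literature.MathematicalPhysics.QuantumLattice

namespace Literature.MathematicalPhysics.QuantumFieldTheory

namespace Tomboulis2007

/-! ### Pointwise identities for the plaquette functions -/

/-- `plaqFn J c U` only depends on the coefficients `c n` with `1 ≤ n ≤ J` (private plumbing). [folklore] -/
private theorem plaqFn_congr {J : ℕ} {c c' : ℕ → ℝ} (h : ∀ n ∈ Icc 1 J, c n = c' n) (U : SU2) :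
    plaqFn J c U = plaqFn J c' U := by
  unfold plaqFn
  congr 1
  exact Finset.sum_congr rfl fun n hn => by rw [h n hn]

/-- `plaqFnTwist J c U` only depends on the coefficients `c n` with `1 ≤ n ≤ J` (private plumbing). [folklore] -/
private theorem plaqFnTwist_congr {J : ℕ} {c c' : ℕ → ℝ} (h : ∀ n ∈ Icc 1 J, c n = c' n) (U : SU2) :
    plaqFnTwist J c U = plaqFnTwist J c' U := by
  unfold plaqFnTwist
  congr 1
  exact Finset.sum_congr rfl fun n hn => by rw [h n hn]

/-- Negating the half-integer-spin coefficients (`n = 2j` odd) turns the plaquette function into the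
twisted plaquette function: `f_{(-1)^n c}(U) = f_c(-U)` (arXiv:0707.2179 eq. (4.4): "only half-integer
representations … are affected"). [cite: Tomboulis2007Confinement, §4 eq. (4.4)] -/
theorem plaqFn_negOdd (J : ℕ) (c : ℕ → ℝ) (U : SU2) :
    plaqFn J (fun n => (-1 : ℝ) ^ n * c n) U = plaqFnTwist J c U := by
  unfold plaqFn plaqFnTwist
  congr 1
  exact Finset.sum_congr rfl fun n _ => by ring

/-- Conversely, negating the half-integer-spin coefficients turns the twisted plaquette function back into
the untwisted one (`((-1)^n)^2 = 1`). [cite: Tomboulis2007Confinement, §4 eq. (4.4)] -/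
theorem plaqFnTwist_negOdd (J : ℕ) (c : ℕ → ℝ) (U : SU2) :
    plaqFnTwist J (fun n => (-1 : ℝ) ^ n * c n) U = plaqFn J c U := by
  unfold plaqFn plaqFnTwist
  congr 1
  refine Finset.sum_congr rfl fun n _ => ?_
  have h : (-1 : ℝ) ^ n * (-1 : ℝ) ^ n = 1 := by
    rw [← mul_pow]; norm_num
  calc (-1 : ℝ) ^ n * ((n : ℝ) + 1) * ((-1 : ℝ) ^ n * c n) * su2Char n U
      = ((-1 : ℝ) ^ n * (-1 : ℝ) ^ n) * (((n : ℝ) + 1) * c n * su2Char n U) := by ring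
    _ = ((n : ℝ) + 1) * c n * su2Char n U := by rw [h, one_mul]

/-! ### The partition functions: negating the odd coefficients = complementing the twist set -/

variable (d L : ℕ) [NeZero L]

/-- **Centre sign flip = complementary twist.** For every spin cut-off `J`, coefficient sequence `c` and
plaquette set `V` of the torus `(ℤ/Lℤ)^d`: the partition function with coefficients `(-1)^n c(n)` twisted
on `V` equals the partition function with coefficients `c` twisted on the complement `Vᶜ` (the integrands
agree pointwise by `plaqFn_negOdd` / `plaqFnTwist_negOdd`). With Tomboulis's mod-2 rule (arXiv:0707.2179
§4, before (4.1): twists on homologous coclosed sets cancel in pairs) this is the lattice form of the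
`β ↦ -β` symmetry of `SU(2)` (Li–Meurice 2005 §4); that rule itself (Haar invariance under `U_b ↦ -U_b`)
is not used or proved here. [cite: Tomboulis2007Confinement, §4 eqs. (4.1)–(4.4)] [cite: LiMeurice2004, §4] -/
theorem torusZtw_negOdd (J : ℕ) (c : ℕ → ℝ) (V : Finset (Plaquette d L)) :
    torusZtw d L J (fun n => (-1 : ℝ) ^ n * c n) V = torusZtw d L J c Vᶜ := by
  unfold torusZtw
  congr 1
  funext U
  refine Finset.prod_congr rfl fun p _ => ?_
  by_cases hp : p ∈ V
  · have hpc : p ∉ Vᶜ := by simpa [Finset.mem_compl] using hp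
    rw [if_pos hp, if_neg hpc, plaqFnTwist_negOdd]
  · have hpc : p ∈ Vᶜ := by simpa [Finset.mem_compl] using hp
    rw [if_neg hp, if_pos hpc, plaqFn_negOdd]

/-- The untwisted partition function at coefficients `(-1)^n c(n)` is the partition function at `c`
twisted on EVERY plaquette. [cite: Tomboulis2007Confinement, §4 eqs. (4.1)–(4.4)] [cite: LiMeurice2004, §4] -/
theorem torusZ_negOdd (J : ℕ) (c : ℕ → ℝ) :
    torusZ d L J (fun n => (-1 : ℝ) ^ n * c n) = torusZtw d L J c Finset.univ := by
  unfold torusZ torusZtw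
  congr 1
  funext U
  refine Finset.prod_congr rfl fun p _ => ?_
  rw [if_pos (Finset.mem_univ p), plaqFn_negOdd]

/-- No twist: `torusZtw … ∅ = torusZ …` — Tomboulis's `Z_Λ(τ_{μν} = 1, β) = Z_Λ(β)` (arXiv:0707.2179 §4,
eqs. (4.2)–(4.4) with an empty twist set). [cite: Tomboulis2007Confinement, §4 eqs. (4.2)–(4.4)] -/
theorem torusZtw_empty (J : ℕ) (c : ℕ → ℝ) :
    torusZtw d L J c ∅ = torusZ d L J c := by
  unfold torusZ torusZtw
  simp only [Finset.notMem_empty, if_false]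

/-- Twisting every plaquette at coefficients `(-1)^n c(n)` gives back the untwisted `Z` at `c`
(the sign flip is an involution: arXiv:0707.2179 §4, before (4.1), "invariant under changes mod 2 in the
number of … sets … carrying a twist" — here the trivial bookkeeping case of the same set twice).
[cite: Tomboulis2007Confinement, §4 eqs. (4.1)–(4.4)] -/
theorem torusZtw_negOdd_univ (J : ℕ) (c : ℕ → ℝ) :
    torusZtw d L J (fun n => (-1 : ℝ) ^ n * c n) Finset.univ = torusZ d L J c := by
  rw [torusZtw_negOdd, Finset.compl_univ, torusZtw_empty]

/-! ### The one-character ray: `s ↦ -s` -/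

/-- If `c` has no integer-spin components up to the cut-off (`c n = 0` for even `n` with `2 ≤ n ≤ J`),
then scaling by `-α` agrees, on the coefficients that matter, with negating the odd entries of the
`α`-scaled sequence (private plumbing). [folklore] -/
private theorem scaleCoeff_neg_eq_negOdd_of_even_vanish {J : ℕ} {c : ℕ → ℝ}
    (hc : ∀ n ∈ Icc 1 J, Even n → c n = 0) (α : ℝ) :
    ∀ n ∈ Icc 1 J, scaleCoeff (-α) c n = (-1 : ℝ) ^ n * scaleCoeff α c n := by
  intro n hn
  unfold scaleCoeff
  rcases Nat.even_or_odd n with he | ho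
  · rw [hc n hn he]; ring
  · rw [ho.neg_one_pow]; ring

/-- **`s ↦ -s` on a ray without integer spins = twist everywhere.** If `c n = 0` for all even `n ≤ J`
(in particular on the one-character ray `J = 1`), then `Z(-α • c) = Z_{univ-twisted}(α • c)`.
[cite: Tomboulis2007Confinement, §4 eqs. (4.1)–(4.4)] [cite: LiMeurice2004, §4] -/
theorem torusZ_scaleCoeff_neg_of_even_vanish (J : ℕ) {c : ℕ → ℝ}
    (hc : ∀ n ∈ Icc 1 J, Even n → c n = 0) (α : ℝ) :
    torusZ d L J (scaleCoeff (-α) c) = torusZtw d L J (scaleCoeff α c) Finset.univ := by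
  have hpt : ∀ U : SU2, plaqFn J (scaleCoeff (-α) c) U =
      plaqFn J (fun n => (-1 : ℝ) ^ n * scaleCoeff α c n) U :=
    fun U => plaqFn_congr (scaleCoeff_neg_eq_negOdd_of_even_vanish hc α) U
  have hZ : torusZ d L J (scaleCoeff (-α) c) = torusZ d L J (fun n => (-1 : ℝ) ^ n * scaleCoeff α c n) := by
    unfold torusZ
    congr 1
    funext U
    exact Finset.prod_congr rfl fun p _ => hpt _
  rw [hZ, torusZ_negOdd]

/-- Same on a twisted partition function: `Z⁻_V(-α • c) = Z_{Vᶜ}(α • c)` when `c` has no integer spins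
up to the cut-off. [cite: Tomboulis2007Confinement, §4 eqs. (4.1)–(4.4)] [cite: LiMeurice2004, §4] -/
theorem torusZtw_scaleCoeff_neg_of_even_vanish (J : ℕ) {c : ℕ → ℝ}
    (hc : ∀ n ∈ Icc 1 J, Even n → c n = 0) (α : ℝ) (V : Finset (Plaquette d L)) :
    torusZtw d L J (scaleCoeff (-α) c) V = torusZtw d L J (scaleCoeff α c) Vᶜ := by
  have hf : ∀ U : SU2, plaqFn J (scaleCoeff (-α) c) U =
      plaqFn J (fun n => (-1 : ℝ) ^ n * scaleCoeff α c n) U :=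
    fun U => plaqFn_congr (scaleCoeff_neg_eq_negOdd_of_even_vanish hc α) U
  have hft : ∀ U : SU2, plaqFnTwist J (scaleCoeff (-α) c) U =
      plaqFnTwist J (fun n => (-1 : ℝ) ^ n * scaleCoeff α c n) U :=
    fun U => plaqFnTwist_congr (scaleCoeff_neg_eq_negOdd_of_even_vanish hc α) U
  have hZ : torusZtw d L J (scaleCoeff (-α) c) V =
      torusZtw d L J (fun n => (-1 : ℝ) ^ n * scaleCoeff α c n) V := by
    unfold torusZtw
    congr 1
    funext U
    refine Finset.prod_congr rfl fun p _ => ?_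
    by_cases hp : p ∈ V
    · rw [if_pos hp, if_pos hp, hft]
    · rw [if_neg hp, if_neg hp, hf]
  rw [hZ, torusZtw_negOdd]

/-- **The one-character ray** (`J = 1`, `f = 1 + 2 s χ_{1/2}`): `Z(-s) = Z_{univ-twisted}(s)`, for every
`c` (only `c 1` enters). This is identity (P2) of the census parity law: with the mod-2 rule it makes
`Z` an even function of `s` on tori all of whose coordinate 2-tori have even area, and equal to a
single-plane `Z⁻(s)` when exactly one of them has odd area. [cite: Tomboulis2007Confinement, §4 eqs. (4.1)–(4.4)] [cite: LiMeurice2004, §4] -/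
theorem torusZ_one_scaleCoeff_neg (c : ℕ → ℝ) (α : ℝ) :
    torusZ d L 1 (scaleCoeff (-α) c) = torusZtw d L 1 (scaleCoeff α c) Finset.univ := by
  refine torusZ_scaleCoeff_neg_of_even_vanish d L 1 (c := c) ?_ α
  intro n hn he
  exfalso
  have h1 : n = 1 := by
    have := Finset.mem_Icc.mp hn
    omega
  exact Nat.not_even_one (h1 ▸ he)

/-- **The one-character ray, twisted:** `Z⁻_V(-s) = Z_{Vᶜ}(s)` for `J = 1`.
[cite: Tomboulis2007Confinement, §4 eqs. (4.1)–(4.4)] [cite: LiMeurice2004, §4] -/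
theorem torusZtw_one_scaleCoeff_neg (c : ℕ → ℝ) (α : ℝ) (V : Finset (Plaquette d L)) :
    torusZtw d L 1 (scaleCoeff (-α) c) V = torusZtw d L 1 (scaleCoeff α c) Vᶜ := by
  refine torusZtw_scaleCoeff_neg_of_even_vanish d L 1 (c := c) ?_ α V
  intro n hn he
  exfalso
  have h1 : n = 1 := by
    have := Finset.mem_Icc.mp hn
    omega
  exact Nat.not_even_one (h1 ▸ he)

end Tomboulis2007

end Literature.MathematicalPhysics.QuantumFieldTheory

end
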